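import Summits.CriticalPhenomena.PercolationContinuityZ3.Theorems.Transplant.FKConnectivityAllQClusterDom
import Summits.CriticalPhenomena.PercolationContinuityZ3.Theorems.PercNearOneGluingNoHeavyLowerTailFKExactEval
import HarnessLib

/-!
# Connectivity correlation inequalities for `φ_{w,q}` — MM (`ClusterDomAdjFKPos`) FAILS for small `q`: refutation by an exact
# computation on the 6-vertex graph `K_{1,1,4}` at `q = 1/1000`

Support file (`--supports stmt-CriticalPhenomena-4575`), census seat `prim-bschramm-census` (gen 20) of the post-continuity
programme; builds on p205010 (kernel theorem, internal audit signed; external expert review pending).  One `abbrev` family and one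
`def` (the listed weighted graph, the event predicate), no named facts, no sorries; standard axioms (`decide`, no `native_decide`).

FINDING (census gen 20, exhaustive levelwise census of fk-1 g10's t-MM over every connected rooted graph on `≤ 6` vertices, all
up-sets; memo bschramm/FROM-census-g20-MM-REFUTED.md).  fk-1 g7's master node MM — "the law of the cluster `C_x` given the
adjacent edge `f = xz` open stochastically dominates its law given `f` closed, for every `q > 0`" — is FALSE in the arboreal corner
(`q → 0` with the activities `p_e/(q(1−p_e))` fixed and large).  WITNESS: `V = Fin 6`, `G = K_{1,1,4}`: hubs `4, 5` adjacent to each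
other and to the leaves `0, 1, 2, 3` (9 listed pairs), parameter `1/11` on the eight leaf–hub pairs, `q = 1/1000`, root `x = 5`,
compared pair `f = 54` (the hub edge), `𝒰 = {S ∋ 0, 1, 2, 3}` ("the cluster of `x` contains every leaf"):
`φ_{w[f↦0]}(C_5 ⊇ leaves) = 34491000000/35151088080100·… = 0.98122140… > 0.98117699… = φ_{w[f↦1]}(C_5 ⊇ leaves)`
(difference `−30940304717190000/696736550558695752241 ≈ −4.44·10⁻⁵`).  Mechanism: with `f` closed, reaching all four leaves from
`5` cheaply uses ONE leaf as a bridge to the hub `4` (configurations `5–j–4` plus one edge per remaining leaf, `32` of them at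
`5` edges) — a route that the contracted world does not reward; in the spanning-forest limit the inequality on `K_{1,1,m}` (hub edge,
all `m` leaves) fails iff the uniform activity exceeds `(2^m − 1)/(m·2^{m−1} + 2 − 2^{m+1})` (`m = 4`: `15/2`; `m = 6`: `63/66 < 1`).
Consequences: the forest shadow `ArborealClusterDomAdjPos` (fk-1 g9) and the levelwise forms t-MM / t-forest-MM (fk-1 g10) are
false as well (same witness family); `ClusterAssocFKPos`, `HubFKPos`, `EdgeNegCorrAdjFKLtOne` are NOT touched by this family
(refuted-substantive for the node as filed `∀ q > 0`; MM stays a theorem for `q ≥ 1`, `clusterDomAdjOn_of_one_le`).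
[cite: Grimmett2006, §1.4 eq. (1.20) (p. 15); §3.9 (p. 63)] [cite: AyyerLinussonRavichandran2025, §7 Conj. 7.1 (p. 22)]
-/

noncomputable section

namespace Summit.CriticalPhenomena.PercolationContinuityZ3.Theorems

namespace FK

open MeasureTheory Set Literature.Probability.LatticeModels Literature.Probability.Percolation
open scoped Classical

namespace ClusterDomCex

/-- The listed weighted graph `K_{1,1,4}` on `Fin 6`: pairs `54, 04, 14, 24, 34, 05, 15, 25, 35` with parameters `a` (the hub pair `f = 54`,
listed FIRST so that the other parameters are a common tail) and `1/11` (the eight leaf–hub pairs), `q = 1/1000`.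
[cite: Grimmett2006, §1.4 eq. (1.20) (p. 15)] -/
abbrev da (a : ℚ) : RCEval :=
  ⟨6, 9, ![5, 0, 1, 2, 3, 0, 1, 2, 3], ![4, 4, 4, 4, 4, 5, 5, 5, 5],
    ![a, 1 / 11, 1 / 11, 1 / 11, 1 / 11, 1 / 11, 1 / 11, 1 / 11, 1 / 11], 1 / 1000⟩

/-- Validity of the base data set (`a = 1/2`). [folklore] -/
theorem valid_h : (da (1 / 2)).Valid := by decide +kernel
/-- Validity, state `f ↦ 1`. [folklore] -/
theorem valid_1 : (da 1).Valid := by decide +kernel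
/-- Validity, state `f ↦ 0`. [folklore] -/
theorem valid_0 : (da 0).Valid := by decide +kernel

/-- Computable predicate of `{C_5 ∋ 0, 1, 2, 3}`. [folklore] -/
def pU (a : ℚ) (t : Finset (Fin 9)) : Bool :=
  (da a).reachB t 5 0 && ((da a).reachB t 5 1 && ((da a).reachB t 5 2 && (da a).reachB t 5 3))

/-- `Z` in the state `f ↦ 1`. [cite: Grimmett2006, §1.4 eq. (1.20) (p. 15)] -/
theorem z1 : (da 1).ZQ = 1982119441 / 2143588810000000 := by decide +kernel
/-- `Z` in the state `f ↦ 0`. [cite: Grimmett2006, §1.4 eq. (1.20) (p. 15)] -/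
theorem z0 : (da 0).ZQ = 351510880801 / 2143588810000000000 := by decide +kernel
/-- Mass of `{C_5 ∋ 0,1,2,3}`, state `f ↦ 1`. [cite: Grimmett2006, §1.4 eq. (1.20) (p. 15)] -/
theorem m1 : (da 1).massQ (pU 1) = 194481 / 214358881000 := by decide +kernel
/-- Mass of `{C_5 ∋ 0,1,2,3}`, state `f ↦ 0`. [cite: Grimmett2006, §1.4 eq. (1.20) (p. 15)] -/
theorem m0 : (da 0).massQ (pU 0) = 34491 / 214358881000 := by decide +kernel

/-- The up-set `{S ∋ 0, 1, 2, 3}` of vertex sets. [folklore] -/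
theorem isUpperSet_U :
    IsUpperSet {S : Set (Fin 6) | (0 : Fin 6) ∈ S ∧ (1 : Fin 6) ∈ S ∧ (2 : Fin 6) ∈ S ∧ (3 : Fin 6) ∈ S} :=
  fun _ _ h hS => ⟨h hS.1, h hS.2.1, h hS.2.2.1, h hS.2.2.2⟩

/-- `conf t ∈ {C_5 ∋ 0, 1, 2, 3}` iff `pU`. [folklore] -/
theorem conf_mem_iff (a : ℚ) (t : Finset (Fin 9)) :
    (da a).conf t ∈ clusterIn (5 : Fin 6)
        {S : Set (Fin 6) | (0 : Fin 6) ∈ S ∧ (1 : Fin 6) ∈ S ∧ (2 : Fin 6) ∈ S ∧ (3 : Fin 6) ∈ S} ↔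
      pU a t = true := by
  unfold pU
  rw [Bool.and_eq_true, Bool.and_eq_true, Bool.and_eq_true, RCEval.reachB_iff, RCEval.reachB_iff, RCEval.reachB_iff,
    RCEval.reachB_iff]
  rfl

/-- **The parameter vector of `da a` is the one-point update at `f = 54` of that of `da ½`.** [cite: Grimmett2006, §1.4 eq. (1.20) (p. 15)] -/
theorem da_w (a : ℚ) (hv : (da a).Valid) (A : unitInterval) (hA : (A : ℝ) = a) :
    ((da a).w : Sym2 (Fin 6) → unitInterval) =
      Function.update ((da (1 / 2)).w : Sym2 (Fin 6) → unitInterval) s((5 : Fin 6), (4 : Fin 6)) A := by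
  have hv0 := valid_h
  have hedge : (da a).edge = (da (1 / 2)).edge := rfl
  have e0 : (da a).edge 0 = s((5 : Fin 6), (4 : Fin 6)) := rfl
  funext e
  by_cases h0 : e = s((5 : Fin 6), (4 : Fin 6))
  · subst h0
    rw [Function.update_self]
    apply Subtype.ext
    rw [hA, ← e0, RCEval.w_edge hv 0]
    rfl
  · rw [Function.update_of_ne h0]
    apply Subtype.ext
    by_cases hr : e ∈ Set.range (da a).edge
    · obtain ⟨i, rfl⟩ := hr
      have hi0 : i ≠ 0 := fun h => h0 (by rw [h, e0])
      obtain ⟨j, rfl⟩ := Fin.exists_succ_eq.2 hi0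
      rw [RCEval.w_edge hv, hedge, RCEval.w_edge hv0]
      simp only [Matrix.cons_val_succ]
    · rw [RCEval.w_eq_zero_of_notMem_range hr]
      rw [hedge] at hr
      rw [RCEval.w_eq_zero_of_notMem_range hr]

end ClusterDomCex

open ClusterDomCex

/-- **MM fails on the vertex type `Fin 6` at `q = 1/1000`**: `¬ ClusterDomAdjOn (Fin 6) (1/1000)` (same witness).
[cite: Grimmett2006, §1.4 eq. (1.20) (p. 15); §3.9 (p. 63)] -/
theorem not_clusterDomAdjOn_fin_six : ¬ ClusterDomAdjOn (Fin 6) ((1 / 1000 : ℚ) : ℝ) := by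
  intro h
  have key := h (da (1 / 2)).w 5 4
    {S : Set (Fin 6) | (0 : Fin 6) ∈ S ∧ (1 : Fin 6) ∈ S ∧ (2 : Fin 6) ∈ S ∧ (3 : Fin 6) ∈ S} isUpperSet_U
  have c1 : ((1 : unitInterval) : ℝ) = ((1 : ℚ) : ℝ) := by simp
  have c0 : ((0 : unitInterval) : ℝ) = ((0 : ℚ) : ℝ) := by simp
  set X : Set (BondConfig (Fin 6)) :=
    clusterIn (5 : Fin 6) {S : Set (Fin 6) | (0 : Fin 6) ∈ S ∧ (1 : Fin 6) ∈ S ∧ (2 : Fin 6) ∈ S ∧ (3 : Fin 6) ∈ S} with hX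
  have key2 : (rcMeasureW (da 0).w ((1 / 1000 : ℚ) : ℝ) ∅).real X ≤ (rcMeasureW (da 1).w ((1 / 1000 : ℚ) : ℝ) ∅).real X := by
    rw [da_w 0 valid_0 0 c0, da_w 1 valid_1 1 c1]
    convert key
  have hq1 : ((1 / 1000 : ℚ) : ℝ) = (((da 1).q : ℚ) : ℝ) := rfl
  rw [hq1] at key2
  rw [RCEval.real_eq_massQ_div valid_0 (P := pU 0) (conf_mem_iff 0),
    RCEval.real_eq_massQ_div valid_1 (P := pU 1) (conf_mem_iff 1), z0, z1, m0, m1] at key2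
  norm_num at key2

/-- **MM fails for small `q`: `¬ ClusterDomAdjFKPos`.**  Witness: `K_{1,1,4}` on `Fin 6` (hubs `4,5`, leaves `0–3`), parameters `1/11`,
`q = 1/1000`, `x = 5`, `z = 4`, `𝒰 = {S ∋ 0,1,2,3}`: `φ_{w[54↦0]}(C_5 ∈ 𝒰) − φ_{w[54↦1]}(C_5 ∈ 𝒰) = 30940304717190000/696736550558695752241 > 0`
(≈ `4.44·10⁻⁵`).  (refuted-substantive: on `K_{1,1,m}` at the hub edge MM fails for EVERY `0 < q < 1` and every edge parameter once `m` is
large — `φ_{f↦0}(𝒰) − φ_{f↦1}(𝒰) = (C/A)^m[(1−q)(B/A)^m − (2v/C)^m](1+o(1))` with `B/A − 2v/C = qv²/(AC) > 0`, `A = q+2v+v²`, `B = q+2v`,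
`C = 2v+v²`, `v = p/(1−p)`; no side condition short of `q ≥ 1` repairs the node as filed.) [cite: Grimmett2006, §1.4 eq. (1.20) (p. 15); §3.9 (p. 63)] -/
theorem not_clusterDomAdjFKPos : ¬ ClusterDomAdjFKPos := by
  intro h
  have hq : (0 : ℝ) < ((1 / 1000 : ℚ) : ℝ) := by norm_num
  exact not_clusterDomAdjOn_fin_six (h ((1 / 1000 : ℚ) : ℝ) hq 6)

end FK

end Summit.CriticalPhenomena.PercolationContinuityZ3.Theorems

end
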